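import Mathlib
import Summits.Ventures.PercRepro2.CoinChainScAbstract
import Summits.Ventures.PercRepro2.CoinChainQstar

/-!
# (SC) for the pure AND-switch chain (blind cell PercRepro2, night-2 g24; NIGHT2-DARC.md §64)

Pure chain data (`ent = ∅`): core law `ν` on `U.powerset`, head values `c ≥ d ≥ d'`; world-1
`R`-law `ν · chainMix ∅ ent' 1 c d` (= `ν c` on the ideal `I = {W ∩ ent' = ∅}`, `ν d` on the entered
clusters `D`), world-1 gate `ν · chainMix ∅ ent' 1 c d'` (= `ν c` on `I`, `ν d'` on `D`).

`chain_modified_state_lsm`: the modified state log-supermodularity of `sc_functional_nonneg` holds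
for the chain — `r N(e) N(e') ≤ g N(∅) N(e ∪ e')` for disjoint states `e, e'` — by two
Ahlswede–Daykin steps: `N(e) N(e') ≤ (∑_I ν d') N(e ∪ e')` (the GLOBAL gate law `ν d'` is
log-supermodular, and the meet of two clusters with disjoint entry states lies in the ideal) and
`(∑_I ν d')(∑_D ν d) ≤ (∑_I ν c)(∑_D ν d')` (the entered clusters are Holley-above the ideal for
the pair `(ν d, ν d')`, by `hdd'` and `d ≤ c`).

`pureChain_SC`: (SC) for the chain, in the cell's moment notation —
`r · Dₚ + g · Iₚ ≥ 0` with `Iₚ = ∑_I ν c (b0 x − b1)(b0 y − b2)`, `Dₚ = ∑_D ν d' (b0 x − b1)(b0 y − b2)`,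
`r = ∑_D ν d`, `g = ∑_D ν d'`.
-/

namespace Summit.Ventures.PercRepro2.Coin

open Classical

section ScChain

variable {V : Type*} [DecidableEq V] {R : Type*} [Field R] [LinearOrder R] [IsStrictOrderedRing R]

omit [LinearOrder R] [IsStrictOrderedRing R] in
/-- Meeting `∅ ∪ ent'` is meeting `ent'`. -/
lemma meets_empty_union (ent' W : Finset V) :
    (∃ r ∈ (∅ : Finset V) ∪ ent', r ∈ W) ↔ (∃ r ∈ ent', r ∈ W) := by
  simp only [Finset.empty_union]

omit [LinearOrder R] [IsStrictOrderedRing R] in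
/-- `W ∩ ent' = ∅` is «`W` does not meet `ent'`». -/
lemma inter_eq_empty_iff_not_meets (ent' W : Finset V) :
    W ∩ ent' = ∅ ↔ ¬ ∃ r ∈ ent', r ∈ W := by
  rw [Finset.eq_empty_iff_forall_notMem]
  constructor
  · rintro h ⟨r, hr, hrW⟩
    exact h r (Finset.mem_inter.mpr ⟨hrW, hr⟩)
  · intro h r hr
    rw [Finset.mem_inter] at hr
    exact h ⟨r, hr.2, hr.1⟩

/-- **The modified state log-supermodularity for the chain.** For disjoint entry states
`e, e'`: `(∑_D ν d) · N(e) N(e') ≤ (∑_D ν d') · N(∅) N(e ∪ e')`, `N(e) = ∑_{W ∩ ent' = e} ν d'`,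
`N(∅) = ∑_I ν c`. -/
theorem chain_modified_state_lsm (U ent' : Finset V) (ν c d d' : Finset V → R)
    (hν0 : ∀ W, 0 ≤ ν W) (hν : ∀ s ⊆ U, ∀ t ⊆ U, ν s * ν t ≤ ν (s ∩ t) * ν (s ∪ t))
    (hc0 : ∀ W, 0 ≤ c W) (hd0 : ∀ W, 0 ≤ d W) (hd'0 : ∀ W, 0 ≤ d' W)
    (hdc : ∀ W, d W ≤ c W)
    (hd'd' : ∀ s t, d' s * d' t ≤ d' (s ∩ t) * d' (s ∪ t))
    (hdd' : ∀ s t, d s * d' t ≤ d (s ∩ t) * d' (s ∪ t))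
    (e e' : Finset V) (h3 : e ∩ e' = ∅) :
    (∑ W ∈ U.powerset.filter (fun W => ¬ (W ∩ ent' = ∅)), ν W * d W) *
        ((∑ W ∈ U.powerset.filter (fun W => W ∩ ent' = e), ν W * d' W) *
          (∑ W ∈ U.powerset.filter (fun W => W ∩ ent' = e'), ν W * d' W)) ≤
      (∑ W ∈ U.powerset.filter (fun W => ¬ (W ∩ ent' = ∅)), ν W * d' W) *
        ((∑ W ∈ U.powerset.filter (fun W => W ∩ ent' = ∅), ν W * c W) *
          (∑ W ∈ U.powerset.filter (fun W => W ∩ ent' = e ∪ e'), ν W * d' W)) := by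
  -- AD₁: N(e) N(e') ≤ (∑_I ν d') N(e ∪ e')
  have hAD1 : (∑ W ∈ U.powerset.filter (fun W => W ∩ ent' = e), ν W * d' W) *
      (∑ W ∈ U.powerset.filter (fun W => W ∩ ent' = e'), ν W * d' W) ≤
      (∑ W ∈ U.powerset.filter (fun W => W ∩ ent' = ∅), ν W * d' W) *
        (∑ W ∈ U.powerset.filter (fun W => W ∩ ent' = e ∪ e'), ν W * d' W) := by
    simp only [Finset.sum_filter]
    have n : ∀ W, (0 : R) ≤ ν W * d' W := fun W => mul_nonneg (hν0 W) (hd'0 W)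
    have n₁ : ∀ W, (0 : R) ≤ (if W ∩ ent' = e then ν W * d' W else 0) := fun W => by
      split_ifs <;> [exact n W; exact le_rfl]
    have n₂ : ∀ W, (0 : R) ≤ (if W ∩ ent' = e' then ν W * d' W else 0) := fun W => by
      split_ifs <;> [exact n W; exact le_rfl]
    have n₃ : ∀ W, (0 : R) ≤ (if W ∩ ent' = ∅ then ν W * d' W else 0) := fun W => by
      split_ifs <;> [exact n W; exact le_rfl]
    have n₄ : ∀ W, (0 : R) ≤ (if W ∩ ent' = e ∪ e' then ν W * d' W else 0) := fun W => by
      split_ifs <;> [exact n W; exact le_rfl]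
    refine ad_pointwise U _ _ _ _ n₁ n₂ n₃ n₄ ?_
    intro s hs t ht
    by_cases hs1 : s ∩ ent' = e
    · by_cases ht1 : t ∩ ent' = e'
      · have hi : (s ∩ t) ∩ ent' = ∅ := by rw [state_inter, hs1, ht1, h3]
        have hu : (s ∪ t) ∩ ent' = e ∪ e' := by rw [state_union, hs1, ht1]
        rw [if_pos hs1, if_pos ht1, if_pos hi, if_pos hu]
        calc ν s * d' s * (ν t * d' t) = (ν s * ν t) * (d' s * d' t) := by ring
          _ ≤ (ν (s ∩ t) * ν (s ∪ t)) * (d' (s ∩ t) * d' (s ∪ t)) :=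
              mul_le_mul (hν s hs t ht) (hd'd' s t) (mul_nonneg (hd'0 _) (hd'0 _))
                (mul_nonneg (hν0 _) (hν0 _))
          _ = ν (s ∩ t) * d' (s ∩ t) * (ν (s ∪ t) * d' (s ∪ t)) := by ring
      · rw [if_neg ht1, mul_zero]; exact mul_nonneg (n₃ _) (n₄ _)
    · rw [if_neg hs1, zero_mul]; exact mul_nonneg (n₃ _) (n₄ _)
  -- AD₂: (∑_I ν d')(∑_D ν d) ≤ (∑_I ν c)(∑_D ν d')
  have hAD2 : (∑ W ∈ U.powerset.filter (fun W => W ∩ ent' = ∅), ν W * d' W) *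
      (∑ W ∈ U.powerset.filter (fun W => ¬ (W ∩ ent' = ∅)), ν W * d W) ≤
      (∑ W ∈ U.powerset.filter (fun W => W ∩ ent' = ∅), ν W * c W) *
        (∑ W ∈ U.powerset.filter (fun W => ¬ (W ∩ ent' = ∅)), ν W * d' W) := by
    simp only [Finset.sum_filter]
    have n₁ : ∀ W, (0 : R) ≤ (if W ∩ ent' = ∅ then ν W * d' W else 0) := fun W => by
      split_ifs <;> [exact mul_nonneg (hν0 W) (hd'0 W); exact le_rfl]
    have n₂ : ∀ W, (0 : R) ≤ (if ¬ (W ∩ ent' = ∅) then ν W * d W else 0) := fun W => by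
      split_ifs <;> first | exact le_rfl | exact mul_nonneg (hν0 W) (hd0 W)
    have n₃ : ∀ W, (0 : R) ≤ (if W ∩ ent' = ∅ then ν W * c W else 0) := fun W => by
      split_ifs <;> [exact mul_nonneg (hν0 W) (hc0 W); exact le_rfl]
    have n₄ : ∀ W, (0 : R) ≤ (if ¬ (W ∩ ent' = ∅) then ν W * d' W else 0) := fun W => by
      split_ifs <;> first | exact le_rfl | exact mul_nonneg (hν0 W) (hd'0 W)
    refine ad_pointwise U _ _ _ _ n₁ n₂ n₃ n₄ ?_
    intro s hs t ht
    by_cases hs1 : s ∩ ent' = ∅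
    · by_cases ht1 : ¬ (t ∩ ent' = ∅)
      · have hi : (s ∩ t) ∩ ent' = ∅ := by rw [state_inter, hs1, Finset.empty_inter]
        have hu : ¬ ((s ∪ t) ∩ ent' = ∅) := by
          rw [state_union, hs1, Finset.empty_union]; exact ht1
        rw [if_pos hs1, if_pos ht1, if_pos hi, if_pos hu]
        have h1 : d t * d' s ≤ d (t ∩ s) * d' (t ∪ s) := hdd' t s
        rw [Finset.inter_comm, Finset.union_comm] at h1
        have h2 : d (s ∩ t) * d' (s ∪ t) ≤ c (s ∩ t) * d' (s ∪ t) :=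
          mul_le_mul_of_nonneg_right (hdc _) (hd'0 _)
        calc ν s * d' s * (ν t * d t) = (ν s * ν t) * (d t * d' s) := by ring
          _ ≤ (ν (s ∩ t) * ν (s ∪ t)) * (c (s ∩ t) * d' (s ∪ t)) :=
              mul_le_mul (hν s hs t ht) (le_trans h1 h2) (mul_nonneg (hd0 _) (hd'0 _))
                (mul_nonneg (hν0 _) (hν0 _))
          _ = ν (s ∩ t) * c (s ∩ t) * (ν (s ∪ t) * d' (s ∪ t)) := by ring
      · rw [if_neg ht1, mul_zero]; exact mul_nonneg (n₃ _) (n₄ _)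
    · rw [if_neg hs1, zero_mul]; exact mul_nonneg (n₃ _) (n₄ _)
  have hNu0 : 0 ≤ ∑ W ∈ U.powerset.filter (fun W => W ∩ ent' = e ∪ e'), ν W * d' W :=
    Finset.sum_nonneg fun W _ => mul_nonneg (hν0 W) (hd'0 W)
  have hr0 : 0 ≤ ∑ W ∈ U.powerset.filter (fun W => ¬ (W ∩ ent' = ∅)), ν W * d W :=
    Finset.sum_nonneg fun W _ => mul_nonneg (hν0 W) (hd0 W)
  calc (∑ W ∈ U.powerset.filter (fun W => ¬ (W ∩ ent' = ∅)), ν W * d W) *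
        ((∑ W ∈ U.powerset.filter (fun W => W ∩ ent' = e), ν W * d' W) *
          (∑ W ∈ U.powerset.filter (fun W => W ∩ ent' = e'), ν W * d' W))
      ≤ (∑ W ∈ U.powerset.filter (fun W => ¬ (W ∩ ent' = ∅)), ν W * d W) *
        ((∑ W ∈ U.powerset.filter (fun W => W ∩ ent' = ∅), ν W * d' W) *
          (∑ W ∈ U.powerset.filter (fun W => W ∩ ent' = e ∪ e'), ν W * d' W)) :=
        mul_le_mul_of_nonneg_left hAD1 hr0
    _ = ((∑ W ∈ U.powerset.filter (fun W => W ∩ ent' = ∅), ν W * d' W) *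
          (∑ W ∈ U.powerset.filter (fun W => ¬ (W ∩ ent' = ∅)), ν W * d W)) *
          (∑ W ∈ U.powerset.filter (fun W => W ∩ ent' = e ∪ e'), ν W * d' W) := by ring
    _ ≤ ((∑ W ∈ U.powerset.filter (fun W => W ∩ ent' = ∅), ν W * c W) *
          (∑ W ∈ U.powerset.filter (fun W => ¬ (W ∩ ent' = ∅)), ν W * d' W)) *
          (∑ W ∈ U.powerset.filter (fun W => W ∩ ent' = e ∪ e'), ν W * d' W) :=
        mul_le_mul_of_nonneg_right hAD2 hNu0
    _ = _ := by ring


/-- **(SC) FOR THE PURE CHAIN.** Moments as in `pureChain_functional_nonneg_of_Qstar`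
(`b0 b1 b2` the world-1 `R`-law); `r = ∑_D ν d`, `g = ∑_D ν d'`; `Dₚ`, `Iₚ` the entered and the
ideal parts of the world-1 gate functional centred at the world-1 `R`-means.  Then
`r · Dₚ + g · Iₚ ≥ 0`. -/
theorem pureChain_SC (U ent' : Finset V) (ν c d d' : Finset V → R)
    (hν0 : ∀ W, 0 ≤ ν W) (hν : ∀ s ⊆ U, ∀ t ⊆ U, ν s * ν t ≤ ν (s ∩ t) * ν (s ∪ t))
    (hc0 : ∀ W, 0 ≤ c W) (hd0 : ∀ W, 0 ≤ d W) (hd'0 : ∀ W, 0 ≤ d' W)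
    (hdc : ∀ W, d W ≤ c W) (hd'c : ∀ W, d' W ≤ c W) (hd'd : ∀ W, d' W ≤ d W)
    (hcc : ∀ s t, c s * c t ≤ c (s ∩ t) * c (s ∪ t))
    (hdd : ∀ s t, d s * d t ≤ d (s ∩ t) * d (s ∪ t))
    (hd'd' : ∀ s t, d' s * d' t ≤ d' (s ∩ t) * d' (s ∪ t))
    (hcd : ∀ s t, c s * d t ≤ c (s ∩ t) * d (s ∪ t))
    (hcd' : ∀ s t, c s * d' t ≤ c (s ∩ t) * d' (s ∪ t))
    (hdd' : ∀ s t, d s * d' t ≤ d (s ∩ t) * d' (s ∪ t))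
    (hratio : ∀ s t, s ⊆ t → d s * c t ≤ c s * d t)
    (hratio' : ∀ s t, s ⊆ t → d' s * c t ≤ c s * d' t)
    (x y : Finset V → R) (hx0 : ∀ W, 0 ≤ x W) (hy0 : ∀ W, 0 ≤ y W)
    (hxm : ∀ s t, x s ≤ x (s ∪ t)) (hym : ∀ s t, y s ≤ y (s ∪ t)) :
    0 ≤ (∑ W ∈ U.powerset.filter (fun W => ∃ r ∈ ent', r ∈ W), ν W * d W) *
          (∑ W ∈ U.powerset.filter (fun W => ∃ r ∈ ent', r ∈ W), ν W * d' W *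
            (((∑ W ∈ U.powerset, ν W * chainMix ∅ ent' 1 c d W) * x W
                - (∑ W ∈ U.powerset, ν W * chainMix ∅ ent' 1 c d W * x W)) *
              ((∑ W ∈ U.powerset, ν W * chainMix ∅ ent' 1 c d W) * y W
                - (∑ W ∈ U.powerset, ν W * chainMix ∅ ent' 1 c d W * y W))))
        + (∑ W ∈ U.powerset.filter (fun W => ∃ r ∈ ent', r ∈ W), ν W * d' W) *
          (∑ W ∈ U.powerset.filter (fun W => ¬ ∃ r ∈ ent', r ∈ W), ν W * c W *
            (((∑ W ∈ U.powerset, ν W * chainMix ∅ ent' 1 c d W) * x W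
                - (∑ W ∈ U.powerset, ν W * chainMix ∅ ent' 1 c d W * x W)) *
              ((∑ W ∈ U.powerset, ν W * chainMix ∅ ent' 1 c d W) * y W
                - (∑ W ∈ U.powerset, ν W * chainMix ∅ ent' 1 c d W * y W)))) := by
  set G : Finset V → R := fun W => ν W * chainMix ∅ ent' 1 c d W with hGdef
  set G' : Finset V → R := fun W => ν W * chainMix ∅ ent' 1 c d' W with hG'def
  have hm0 : ∀ W, 0 ≤ chainMix ∅ ent' 1 c d W :=
    chainMix_nonneg ∅ ent' (by norm_num) (le_refl 1) hc0 hd0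
  have hm'0 : ∀ W, 0 ≤ chainMix ∅ ent' 1 c d' W :=
    chainMix_nonneg ∅ ent' (by norm_num) (le_refl 1) hc0 hd'0
  have hG0 : ∀ W, 0 ≤ G W := fun W => mul_nonneg (hν0 W) (hm0 W)
  have hG'0 : ∀ W, 0 ≤ G' W := fun W => mul_nonneg (hν0 W) (hm'0 W)
  have hG'G : ∀ W, G' W ≤ G W := fun W =>
    mul_le_mul_of_nonneg_left (chainMix_one_mono ∅ ent' hd'd W) (hν0 W)
  have hmix := mixture_lsm ∅ ent' 1 (by norm_num) (le_refl 1) c d hc0 hd0 hdc hcc hdd hcd hratio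
  have hmix' := mixture_lsm ∅ ent' 1 (by norm_num) (le_refl 1) c d' hc0 hd'0 hd'c hcc hd'd' hcd'
    hratio'
  have wLL : ∀ s ⊆ U, ∀ t ⊆ U, G s * G t ≤ G (s ∩ t) * G (s ∪ t) := by
    intro s hs t ht
    simp only [hGdef]
    calc ν s * chainMix ∅ ent' 1 c d s * (ν t * chainMix ∅ ent' 1 c d t)
        = (ν s * ν t) * (chainMix ∅ ent' 1 c d s * chainMix ∅ ent' 1 c d t) := by ring
      _ ≤ (ν (s ∩ t) * ν (s ∪ t)) *
            (chainMix ∅ ent' 1 c d (s ∩ t) * chainMix ∅ ent' 1 c d (s ∪ t)) :=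
          mul_le_mul (hν s hs t ht) (hmix s t) (mul_nonneg (hm0 _) (hm0 _))
            (mul_nonneg (hν0 _) (hν0 _))
      _ = _ := by ring
  have wMM : ∀ s ⊆ U, ∀ t ⊆ U, G' s * G' t ≤ G' (s ∩ t) * G' (s ∪ t) := by
    intro s hs t ht
    simp only [hG'def]
    calc ν s * chainMix ∅ ent' 1 c d' s * (ν t * chainMix ∅ ent' 1 c d' t)
        = (ν s * ν t) * (chainMix ∅ ent' 1 c d' s * chainMix ∅ ent' 1 c d' t) := by ring
      _ ≤ (ν (s ∩ t) * ν (s ∪ t)) *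
            (chainMix ∅ ent' 1 c d' (s ∩ t) * chainMix ∅ ent' 1 c d' (s ∪ t)) :=
          mul_le_mul (hν s hs t ht) (hmix' s t) (mul_nonneg (hm'0 _) (hm'0 _))
            (mul_nonneg (hν0 _) (hν0 _))
      _ = _ := by ring
  have wML : ∀ s ⊆ U, ∀ t ⊆ U, (∃ r ∈ ent', r ∈ s) →
      G' s * G t ≤ G (s ∩ t) * G' (s ∪ t) := by
    intro s hs t ht hse
    have hse' : ∃ r ∈ (∅ : Finset V) ∪ ent', r ∈ s := (meets_empty_union ent' s).mpr hse
    have hsu : ∃ r ∈ (∅ : Finset V) ∪ ent', r ∈ s ∪ t := by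
      obtain ⟨r, hr, hrs⟩ := hse'; exact ⟨r, hr, Finset.mem_union_left _ hrs⟩
    simp only [hGdef, hG'def]
    rw [chainMix_one_of_meet ∅ ent' c d' hse', chainMix_one_of_meet ∅ ent' c d' hsu]
    calc ν s * d' s * (ν t * chainMix ∅ ent' 1 c d t)
        = (ν s * ν t) * (d' s * chainMix ∅ ent' 1 c d t) := by ring
      _ ≤ (ν (s ∩ t) * ν (s ∪ t)) * (chainMix ∅ ent' 1 c d (s ∩ t) * d' (s ∪ t)) :=
          mul_le_mul (hν s hs t ht)
            (chain_cross_holley ∅ ent' 1 (by norm_num) (le_refl 1) c d d' hdc hcd' hdd' hd'0 s t)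
            (mul_nonneg (hd'0 _) (hm0 _)) (mul_nonneg (hν0 _) (hν0 _))
      _ = _ := by ring
  have hnoI : ∀ W : Finset V, W ∩ ent' = ∅ → ¬ ∃ r ∈ (∅ : Finset V) ∪ ent', r ∈ W := by
    intro W hW h
    exact ((inter_eq_empty_iff_not_meets ent' W).mp hW) ((meets_empty_union ent' W).mp h)
  have hI : ∀ W, W ∩ ent' = ∅ → G' W = G W := by
    intro W hW
    simp only [hGdef, hG'def]
    rw [chainMix_of_not_meet ∅ ent' 1 c d (hnoI W hW), chainMix_of_not_meet ∅ ent' 1 c d' (hnoI W hW)]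
  -- the laws on the entered clusters and on the ideal
  have hGD : ∀ W, ¬ (W ∩ ent' = ∅) → G W = ν W * d W := by
    intro W hW
    have h : ∃ r ∈ ent', r ∈ W := by
      by_contra hno; exact hW ((inter_eq_empty_iff_not_meets ent' W).mpr hno)
    simp only [hGdef]
    rw [chainMix_one_of_meet ∅ ent' c d ((meets_empty_union ent' W).mpr h)]
  have hG'D : ∀ W, ¬ (W ∩ ent' = ∅) → G' W = ν W * d' W := by
    intro W hW
    have h : ∃ r ∈ ent', r ∈ W := by
      by_contra hno; exact hW ((inter_eq_empty_iff_not_meets ent' W).mpr hno)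
    simp only [hG'def]
    rw [chainMix_one_of_meet ∅ ent' c d' ((meets_empty_union ent' W).mpr h)]
  have hGI : ∀ W, W ∩ ent' = ∅ → G W = ν W * c W := by
    intro W hW
    simp only [hGdef]
    rw [chainMix_of_not_meet ∅ ent' 1 c d (hnoI W hW)]
  have hG'I : ∀ W, W ∩ ent' = ∅ → G' W = ν W * c W := by
    intro W hW
    simp only [hG'def]
    rw [chainMix_of_not_meet ∅ ent' 1 c d' (hnoI W hW)]
  -- the modified state log-supermodularity
  have hmod : ∀ e ⊆ ent', ∀ e' ⊆ ent', e ∩ e' = ∅ → e ≠ ∅ → e' ≠ ∅ →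
      (∑ W ∈ U.powerset.filter (fun W => ¬ (W ∩ ent' = ∅)), G W) *
          ((∑ W ∈ U.powerset.filter (fun W => W ∩ ent' = e), G' W) *
            (∑ W ∈ U.powerset.filter (fun W => W ∩ ent' = e'), G' W)) ≤
        (∑ W ∈ U.powerset.filter (fun W => ¬ (W ∩ ent' = ∅)), G' W) *
          ((∑ W ∈ U.powerset.filter (fun W => W ∩ ent' = ∅), G' W) *
            (∑ W ∈ U.powerset.filter (fun W => W ∩ ent' = e ∪ e'), G' W)) := by
    intro e he e' he' h3 h1 h2
    have key := chain_modified_state_lsm U ent' ν c d d' hν0 hν hc0 hd0 hd'0 hdc hd'd' hdd' e e' h3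
    have hD1 : (∑ W ∈ U.powerset.filter (fun W => ¬ (W ∩ ent' = ∅)), G W) =
        ∑ W ∈ U.powerset.filter (fun W => ¬ (W ∩ ent' = ∅)), ν W * d W :=
      Finset.sum_congr rfl fun W hW => hGD W (Finset.mem_filter.mp hW).2
    have hD2 : (∑ W ∈ U.powerset.filter (fun W => ¬ (W ∩ ent' = ∅)), G' W) =
        ∑ W ∈ U.powerset.filter (fun W => ¬ (W ∩ ent' = ∅)), ν W * d' W :=
      Finset.sum_congr rfl fun W hW => hG'D W (Finset.mem_filter.mp hW).2
    have hIe : (∑ W ∈ U.powerset.filter (fun W => W ∩ ent' = ∅), G' W) =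
        ∑ W ∈ U.powerset.filter (fun W => W ∩ ent' = ∅), ν W * c W :=
      Finset.sum_congr rfl fun W hW => hG'I W (Finset.mem_filter.mp hW).2
    have hstate : ∀ f : Finset V, f ≠ ∅ →
        (∑ W ∈ U.powerset.filter (fun W => W ∩ ent' = f), G' W) =
          ∑ W ∈ U.powerset.filter (fun W => W ∩ ent' = f), ν W * d' W := by
      intro f hf
      refine Finset.sum_congr rfl fun W hW => ?_
      have hWf := (Finset.mem_filter.mp hW).2
      exact hG'D W (by rw [hWf]; exact hf)
    have hu : e ∪ e' ≠ ∅ := fun h => h1 (Finset.union_eq_empty.mp h).1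
    rw [hD1, hD2, hIe, hstate e h1, hstate e' h2, hstate (e ∪ e') hu]
    exact key
  have key := sc_functional_nonneg U ent' G G' x y hG0 hG'0 hG'G hx0 hy0 hxm hym wLL wMM wML hI hmod
  -- back to the chain's moment notation
  have hfD : U.powerset.filter (fun W => ¬ (W ∩ ent' = ∅)) =
      U.powerset.filter (fun W => ∃ r ∈ ent', r ∈ W) := by
    refine Finset.filter_congr fun W _ => ?_
    rw [inter_eq_empty_iff_not_meets, not_not]
  have hfI : U.powerset.filter (fun W => W ∩ ent' = ∅) =
      U.powerset.filter (fun W => ¬ ∃ r ∈ ent', r ∈ W) := by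
    refine Finset.filter_congr fun W _ => ?_
    rw [inter_eq_empty_iff_not_meets]
  have hsD : ∀ h : Finset V → R, (∑ W ∈ U.powerset.filter (fun W => ¬ (W ∩ ent' = ∅)), G W * h W) =
      ∑ W ∈ U.powerset.filter (fun W => ∃ r ∈ ent', r ∈ W), ν W * d W * h W := by
    intro h; rw [← hfD]
    exact Finset.sum_congr rfl fun W hW => by rw [hGD W (Finset.mem_filter.mp hW).2]
  have hsD' : ∀ h : Finset V → R, (∑ W ∈ U.powerset.filter (fun W => ¬ (W ∩ ent' = ∅)), G' W * h W) =
      ∑ W ∈ U.powerset.filter (fun W => ∃ r ∈ ent', r ∈ W), ν W * d' W * h W := by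
    intro h; rw [← hfD]
    exact Finset.sum_congr rfl fun W hW => by rw [hG'D W (Finset.mem_filter.mp hW).2]
  have hsI : ∀ h : Finset V → R, (∑ W ∈ U.powerset.filter (fun W => W ∩ ent' = ∅), G W * h W) =
      ∑ W ∈ U.powerset.filter (fun W => ¬ ∃ r ∈ ent', r ∈ W), ν W * c W * h W := by
    intro h; rw [← hfI]
    exact Finset.sum_congr rfl fun W hW => by rw [hGI W (Finset.mem_filter.mp hW).2]
  have hsD1 : (∑ W ∈ U.powerset.filter (fun W => ¬ (W ∩ ent' = ∅)), G W) =
      ∑ W ∈ U.powerset.filter (fun W => ∃ r ∈ ent', r ∈ W), ν W * d W := by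
    have := hsD (fun _ => (1 : R)); simpa only [mul_one] using this
  have hsD1' : (∑ W ∈ U.powerset.filter (fun W => ¬ (W ∩ ent' = ∅)), G' W) =
      ∑ W ∈ U.powerset.filter (fun W => ∃ r ∈ ent', r ∈ W), ν W * d' W := by
    have := hsD' (fun _ => (1 : R)); simpa only [mul_one] using this
  rw [hsD1, hsD1', hsD', hsI] at key
  exact key

end ScChain

end Summit.Ventures.PercRepro2.Coin
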